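import Summits.QuantumAdvantage.AdviceFreeQNC0.AffBells27WindowUpgradeReduction
import Summits.QuantumAdvantage.AdviceFreeQNC0.AffBells27Dichotomy
import Summits.QuantumAdvantage.AdviceFreeQNC0.AffBells27MismatchLoss
import Mathlib.Algebra.BigOperators.Field
import HarnessLib

/-!
# THE WINDOW COUNT and `AffBells26.DensityUpgradeWin` PROVED (planner qn-p1 g27, ROUND-26 §4; ask P-27c, proof half)

Prover seat qn-prover-3 g14.  **`windowCount`**: for `N ≥ 5` and every `Z, β, c`,
`Σ_{x odd} refFrac β c Z x ≤ 2^{Z+3} · #{ℓ odd : (β, c) loses on ℓ}`;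
hence (`densityUpgradeWin_of_count`, `AffBells27WindowUpgradeReduction.lean`) **`densityUpgradeWin : DensityUpgradeWin`**, and with
`AffBells27Dichotomy.affBellsPolyLoss3_of` the (NP₁) rung `AffBellsPolyLoss3` now follows from the ONE open statement `HWFar₀`
(`affBellsPolyLoss3_of_HWFar₀`).

The double count (ROUND-26 §4, made injection-free).  (1) `card_refuting_le`: a refuting candidate `(C₀, F)` at `x` has a point `x'` of
the sub-fibre `SubFibre x C₀` where the moves form a move system and the cube mismatches, hence (`exists_lost_of_mismatch`) a LOST cube
point `ℓ = x'_S`; since `x' = ℓ_S` (`xF_xF`), the refuting indicator is bounded by `Σ_{S, ℓ lost} [ℓ_S ∈ SubFibre x C₀]`.  (2) Divide by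
`#windowCands x Z = #PZ(x) · #T` (`PZ(x)` = `Z`-subsets of the coins of `x`, `T` = window triples) and exchange sums: the total is
`Σ_{(F, S, ℓ)} g(ℓ_S)` with `g(y) = Σ_{x odd} Σ_{C₀ ∈ PZ(x)} [y ∈ SubFibre x C₀] / (#PZ(x) · #T)`.  (3) `inner_le`: `y ∈ SubFibre x C₀` forces
`kline x = kline y`, so `PZ(x) = PZ(y)`, and for each `C₀` at most `2^Z` points `x` agree with `y` off `C₀` (`card_agree_off_le`); so
`g(y) ≤ 2^Z / #T`.  (4) There are `#T · 8 · #lost` triples: total `≤ 2^{Z+3} · #lost`.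
WHAT THIS IS NOT: `HWFar₀` (the crux of the window side) is NOT touched; separation NOT moved.
-/

namespace Summit.QuantumAdvantage.AdviceFreeQNC0

namespace AffBells26

open Finset Literature.Computability.QuantumComplexity Literature.Computability.QuantumComplexity.RingHLF
open AffBells23 Fib19

variable {N : ℕ}

/-! ### Step 1: refuting candidates are witnessed by lost cube points -/

/-- Applying the moves of `S` twice returns to the start. -/
theorem xF_xF {m : ℕ} (x : Fin N → Bool) (F : Fin m → Finset (Fin N)) (S : Finset (Fin m)) : xF (xF x F S) F S = x := by
  unfold xF
  exact flipAt_flipAt x _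

open scoped Classical in
/-- **Numerator bound**: `#refuting candidates at x ≤ Σ_{C₀ ∈ PZ(x)} Σ_{(F, S, ℓ)} [ℓ_S ∈ SubFibre x C₀]` (`ℓ` lost, `F` a window triple). -/
theorem card_refuting_le (hN : 5 ≤ N) (β : Fin N → Fin N → ZMod 3) (c : Fin N → ZMod 3) (Z : ℕ) (x : Fin N → Bool) :
    ((windowCands x Z).filter fun p => ClassRefutes β c x p.1 p.2).card ≤
      ∑ C₀ ∈ (klineZeros x).powersetCard Z,
        ∑ r ∈ ((univ : Finset (Fin 3 → Finset (Fin N))).filter fun F => ∀ j, F j ∈ win4 N) ×ˢ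
            ((univ : Finset (Finset (Fin 3))) ×ˢ
              (((univ : Finset (Fin N → Bool)).filter fun ℓ => IsOdd ℓ).filter
                fun ℓ => ¬ RingHLF.Rel ℓ (affBell β c ℓ))),
          if xF r.2.2 r.1 r.2.1 ∈ SubFibre x C₀ then 1 else 0 := by
  rw [card_filter]
  unfold windowCands
  rw [sum_product]
  refine sum_le_sum fun C₀ _ => ?_
  rw [sum_product]
  refine sum_le_sum fun F hF => ?_
  split_ifs with h
  · obtain ⟨x', hx', hMS, hMis⟩ := h
    obtain ⟨S, hoddS, hlost⟩ := exists_lost_of_mismatch hN (by norm_num) β c hMS hMis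
    have hq : (S, xF x' F S) ∈ (univ : Finset (Finset (Fin 3))) ×ˢ
        (((univ : Finset (Fin N → Bool)).filter fun ℓ => IsOdd ℓ).filter fun ℓ => ¬ RingHLF.Rel ℓ (affBell β c ℓ)) := by
      rw [mem_product]
      refine ⟨mem_univ _, ?_⟩
      rw [mem_filter, mem_filter]
      exact ⟨⟨mem_univ _, hoddS⟩, hlost⟩
    refine le_trans ?_ (single_le_sum (f := fun q : Finset (Fin 3) × (Fin N → Bool) =>
      if xF q.2 F q.1 ∈ SubFibre x C₀ then 1 else 0) (fun _ _ => Nat.zero_le _) hq)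
    simp only
    rw [xF_xF, if_pos hx']
  · exact Nat.zero_le _

/-! ### Step 3: the fibre over a point -/

/-- Points agreeing with `y` off `C₀` are flips of `y` inside `C₀`: at most `2^{|C₀|}` of them. -/
theorem card_agree_off_le (y : Fin N → Bool) (C₀ : Finset (Fin N)) (s : Finset (Fin N → Bool)) :
    (s.filter fun x => ∀ i, i ∉ C₀ → y i = x i).card ≤ 2 ^ C₀.card := by
  classical
  calc (s.filter fun x => ∀ i, i ∉ C₀ → y i = x i).card
      ≤ ((C₀.powerset).image fun P => flipAt y P).card := by
        refine card_le_card fun x hx => ?_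
        rw [mem_filter] at hx
        rw [mem_image]
        refine ⟨C₀.filter fun i => x i ≠ y i, mem_powerset.2 (filter_subset _ _), ?_⟩
        funext i
        unfold flipAt
        by_cases hi : i ∈ C₀.filter fun i => x i ≠ y i
        · rw [decide_eq_true hi]
          have hne : x i ≠ y i := (mem_filter.1 hi).2
          revert hne
          cases x i <;> cases y i <;> decide
        · rw [decide_eq_false hi, Bool.xor_false]
          by_cases hiC : i ∈ C₀
          · by_contra hne
            exact hi (mem_filter.2 ⟨hiC, fun h => hne h.symm⟩)
          · exact hx.2 i hiC
    _ ≤ (C₀.powerset).card := card_image_le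
    _ = 2 ^ C₀.card := card_powerset _

/-- **Inner bound**: `g(y) = Σ_{x odd} Σ_{C₀ ∈ PZ(x)} [y ∈ SubFibre x C₀] / (#PZ(x)·T) ≤ 2^Z / T`. -/
theorem inner_le (Z : ℕ) {T : ℝ} (hT : 0 ≤ T) (y : Fin N → Bool) :
    (∑ x ∈ (univ : Finset (Fin N → Bool)).filter (fun x => IsOdd x),
      ∑ C₀ ∈ (klineZeros x).powersetCard Z,
        (if y ∈ SubFibre x C₀ then (1 : ℝ) else 0) / ((((klineZeros x).powersetCard Z).card : ℝ) * T)) ≤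
      (2 : ℝ) ^ Z / T := by
  classical
  -- replace PZ(x) by PZ(y) termwise
  have hterm : ∀ x ∈ (univ : Finset (Fin N → Bool)).filter (fun x => IsOdd x),
      (∑ C₀ ∈ (klineZeros x).powersetCard Z,
        (if y ∈ SubFibre x C₀ then (1 : ℝ) else 0) / ((((klineZeros x).powersetCard Z).card : ℝ) * T)) =
      ∑ C₀ ∈ (klineZeros y).powersetCard Z,
        (if y ∈ SubFibre x C₀ then (1 : ℝ) else 0) / ((((klineZeros y).powersetCard Z).card : ℝ) * T) := by
    intro x _
    by_cases hk : kline y = kline x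
    · have : klineZeros x = klineZeros y := by unfold klineZeros; rw [hk]
      rw [this]
    · have h0 : ∀ C₀, ¬ (y ∈ SubFibre x C₀) := by
        intro C₀ h
        unfold SubFibre at h
        rw [mem_filter] at h
        exact hk h.2.2.1
      simp only [h0, if_false, zero_div, sum_const_zero]
  rw [sum_congr rfl hterm, sum_comm]
  -- the count over the fibre
  have hcount : ∀ C₀ ∈ (klineZeros y).powersetCard Z,
      (∑ x ∈ (univ : Finset (Fin N → Bool)).filter (fun x => IsOdd x), (if y ∈ SubFibre x C₀ then (1 : ℝ) else 0)) ≤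
        (2 : ℝ) ^ Z := by
    intro C₀ hC₀
    rw [mem_powersetCard] at hC₀
    rw [← sum_filter, sum_const, nsmul_eq_mul, mul_one]
    have hsub : (((univ : Finset (Fin N → Bool)).filter (fun x => IsOdd x)).filter fun x => y ∈ SubFibre x C₀).card ≤
        (((univ : Finset (Fin N → Bool)).filter (fun x => IsOdd x)).filter fun x => ∀ i, i ∉ C₀ → y i = x i).card := by
      refine card_le_card fun x hx => ?_
      rw [mem_filter] at hx ⊢
      refine ⟨hx.1, ?_⟩
      have h := hx.2
      unfold SubFibre at h
      rw [mem_filter] at h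
      exact h.2.2.2
    have h2 := card_agree_off_le y C₀ ((univ : Finset (Fin N → Bool)).filter (fun x => IsOdd x))
    rw [hC₀.2] at h2
    exact_mod_cast hsub.trans h2
  calc ∑ C₀ ∈ (klineZeros y).powersetCard Z, ∑ x ∈ (univ : Finset (Fin N → Bool)).filter (fun x => IsOdd x),
          (if y ∈ SubFibre x C₀ then (1 : ℝ) else 0) / ((((klineZeros y).powersetCard Z).card : ℝ) * T)
      = ∑ C₀ ∈ (klineZeros y).powersetCard Z, (∑ x ∈ (univ : Finset (Fin N → Bool)).filter (fun x => IsOdd x),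
          (if y ∈ SubFibre x C₀ then (1 : ℝ) else 0)) / ((((klineZeros y).powersetCard Z).card : ℝ) * T) := by
        refine sum_congr rfl fun C₀ _ => ?_
        rw [sum_div]
    _ ≤ ∑ C₀ ∈ (klineZeros y).powersetCard Z, (2 : ℝ) ^ Z / ((((klineZeros y).powersetCard Z).card : ℝ) * T) := by
        refine sum_le_sum fun C₀ hC₀ => ?_
        exact div_le_div_of_nonneg_right (hcount C₀ hC₀) (by positivity)
    _ = (((klineZeros y).powersetCard Z).card : ℝ) * ((2 : ℝ) ^ Z / ((((klineZeros y).powersetCard Z).card : ℝ) * T)) := by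
        rw [sum_const, nsmul_eq_mul]
    _ ≤ (2 : ℝ) ^ Z / T := by
        by_cases hP : (((klineZeros y).powersetCard Z).card : ℝ) = 0
        · rw [hP, zero_mul]
          exact div_nonneg (by positivity) hT
        · rw [mul_div_assoc', mul_div_mul_left _ _ hP]

/-! ### The count -/

/-- **The window count**: `Σ_{x odd} refFrac β c Z x ≤ 2^{Z+3} · #{odd losers}`. -/
theorem windowCount (hN : 5 ≤ N) (Z : ℕ) (β : Fin N → Fin N → ZMod 3) (c : Fin N → ZMod 3) :
    (∑ x ∈ (univ : Finset (Fin N → Bool)).filter (fun x => IsOdd x), refFrac β c Z x) ≤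
      (2 : ℝ) ^ (Z + 3) * ((((univ : Finset (Fin N → Bool)).filter fun x => IsOdd x).filter
        fun ℓ => ¬ RingHLF.Rel ℓ (affBell β c ℓ)).card : ℝ) := by
  classical
  set Odd := (univ : Finset (Fin N → Bool)).filter (fun x => IsOdd x) with hOdd
  set Lost := Odd.filter fun ℓ => ¬ RingHLF.Rel ℓ (affBell β c ℓ) with hLost
  set Tw := (univ : Finset (Fin 3 → Finset (Fin N))).filter (fun F => ∀ j, F j ∈ win4 N) with hTw
  set R := Tw ×ˢ ((univ : Finset (Finset (Fin 3))) ×ˢ Lost) with hR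
  -- pointwise bound on refFrac
  have hpt : ∀ x ∈ Odd, refFrac β c Z x ≤
      ∑ C₀ ∈ (klineZeros x).powersetCard Z, ∑ r ∈ R,
        (if xF r.2.2 r.1 r.2.1 ∈ SubFibre x C₀ then (1 : ℝ) else 0) /
          ((((klineZeros x).powersetCard Z).card : ℝ) * (Tw.card : ℝ)) := by
    intro x _
    unfold refFrac
    have hW : ((windowCands x Z).card : ℝ) = (((klineZeros x).powersetCard Z).card : ℝ) * (Tw.card : ℝ) := by
      unfold windowCands
      rw [card_product]
      push_cast
      rfl
    have hnum := card_refuting_le hN β c Z x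
    rw [hW]
    have hcast : ((((windowCands x Z).filter fun p => ClassRefutes β c x p.1 p.2).card : ℕ) : ℝ) ≤
        ∑ C₀ ∈ (klineZeros x).powersetCard Z, ∑ r ∈ R,
          (if xF r.2.2 r.1 r.2.1 ∈ SubFibre x C₀ then (1 : ℝ) else 0) := by
      have := (Nat.cast_le (α := ℝ)).2 hnum
      push_cast at this
      exact this
    calc ((((windowCands x Z).filter fun p => ClassRefutes β c x p.1 p.2).card : ℕ) : ℝ) /
          ((((klineZeros x).powersetCard Z).card : ℝ) * (Tw.card : ℝ))
        ≤ (∑ C₀ ∈ (klineZeros x).powersetCard Z, ∑ r ∈ R,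
            (if xF r.2.2 r.1 r.2.1 ∈ SubFibre x C₀ then (1 : ℝ) else 0)) /
            ((((klineZeros x).powersetCard Z).card : ℝ) * (Tw.card : ℝ)) :=
          div_le_div_of_nonneg_right hcast (by positivity)
      _ = _ := by
          rw [sum_div]
          refine sum_congr rfl fun C₀ _ => ?_
          rw [sum_div]
  -- exchange the sums and bound the inner one
  have hTw0 : (0 : ℝ) ≤ (Tw.card : ℝ) := Nat.cast_nonneg _
  calc (∑ x ∈ Odd, refFrac β c Z x)
      ≤ ∑ x ∈ Odd, ∑ C₀ ∈ (klineZeros x).powersetCard Z, ∑ r ∈ R,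
          (if xF r.2.2 r.1 r.2.1 ∈ SubFibre x C₀ then (1 : ℝ) else 0) /
            ((((klineZeros x).powersetCard Z).card : ℝ) * (Tw.card : ℝ)) := sum_le_sum hpt
    _ = ∑ x ∈ Odd, ∑ r ∈ R, ∑ C₀ ∈ (klineZeros x).powersetCard Z,
          (if xF r.2.2 r.1 r.2.1 ∈ SubFibre x C₀ then (1 : ℝ) else 0) /
            ((((klineZeros x).powersetCard Z).card : ℝ) * (Tw.card : ℝ)) := by
        refine sum_congr rfl fun x _ => ?_
        rw [sum_comm]
    _ = ∑ r ∈ R, ∑ x ∈ Odd, ∑ C₀ ∈ (klineZeros x).powersetCard Z,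
          (if xF r.2.2 r.1 r.2.1 ∈ SubFibre x C₀ then (1 : ℝ) else 0) /
            ((((klineZeros x).powersetCard Z).card : ℝ) * (Tw.card : ℝ)) := sum_comm
    _ ≤ ∑ r ∈ R, (2 : ℝ) ^ Z / (Tw.card : ℝ) := sum_le_sum fun r _ => inner_le Z hTw0 _
    _ = (R.card : ℝ) * ((2 : ℝ) ^ Z / (Tw.card : ℝ)) := by rw [sum_const, nsmul_eq_mul]
    _ ≤ (2 : ℝ) ^ (Z + 3) * (Lost.card : ℝ) := by
        have hRcard : (R.card : ℝ) = (Tw.card : ℝ) * (8 * (Lost.card : ℝ)) := by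
          rw [hR, card_product, card_product, card_univ, Fintype.card_finset, Fintype.card_fin]
          push_cast
          ring
        rw [hRcard]
        by_cases hT : (Tw.card : ℝ) = 0
        · rw [hT, zero_mul, zero_mul]
          positivity
        · rw [pow_add]
          field_simp
          ring_nf
          rfl

/-- **`DensityUpgradeWin` holds.** -/
theorem densityUpgradeWin : DensityUpgradeWin :=
  densityUpgradeWin_of_count fun _ hN Z β c => windowCount hN Z β c

/-- **(NP₁) from `HWFar₀` alone**: with the windowed density upgrade proved, the inverse-polynomial loss rung `AffBellsPolyLoss3` follows from
the one open statement `HWFar₀` of the revised dichotomy (`AffBells27Dichotomy.affBellsPolyLoss3_of`). -/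
theorem affBellsPolyLoss3_of_HWFar₀ (hW : HWFar₀) : AffBellsPolyLoss3 := affBellsPolyLoss3_of densityUpgradeWin hW

end AffBells26

end Summit.QuantumAdvantage.AdviceFreeQNC0
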